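import Literature.Analysis.FluidPDE.TaoCascadeZeroScaleRotorPhase
import HarnessLib

/-!
# Tao's cascade ODE, §6.7: `b₀` affine around `εt` and the explicit lower bound for `c₀` before `t_c` ((6.157)–(6.158))

T. Tao, *Finite time blowup for an averaged three-dimensional Navier–Stokes equation*,
J. Amer. Math. Soc. **29** (2016), 601–674 = arXiv:1402.0290v3, §6.7: (6.157)
"`ε(t - 10⁻⁵ - O(K⁻⁹)) ≤ b₀(t) ≤ ε(t + 10⁻⁵ + O(K⁻⁹))` for all `0 ≤ t ≤ t_c`", and the display
before (6.158): "by (6.57), (6.157) and Gronwall's inequality we see that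
`c₀(t) ≳ exp((t²/2 - 10⁻⁵t - 1 + O(K⁻⁹))K^{10}) ε²` whenever `1/2 ≤ t ≤ t_c`. Comparing this with
(6.153) we see that `t_c ≤ 2`."

Over `RescaledHypotheses γ …` (`TaoCascadeRescaled.lean`) on an interval `[0, T]` on which `Ẽ₀ ≤ 1`,
`|a₀² - 1| ≤ c_A` (from (6.156)) and `|c₀| ≤ C` (the definition of `t_c`):

* `zero_b_affine`: `εt - p ≤ b₀(t) ≤ εt + p` with `p = 10⁻⁵ε + (εc_A + ε⁻¹K^{10}C² + η)T`
  (`η = C₁(1+ε₀)^{-n₀/2}`; the initial value `|b₀(0)| ≤ 10⁻⁵ε` is (6.55));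
* `zero_c_lower_explicit`: for `w ≤ t ≤ T` (`0 < w`),
  `c₀(t) ≥ exp(ε⁻¹K^{10}(εt²/2 - pt))·((ε²e^{-K^{10}}(1 - c_A) - η) w e^{-ε⁻¹K^{10}(εw²/2 + pw)} - (1+ε₀)^{-n₀/4})`
  provided the last factor is nonnegative and `η ≤ ε²e^{-K^{10}}(1 - c_A)` (`c₀(0) ≥ -(1+ε₀)^{-n₀/4}`
  is (6.57)), via `c_lower_of_affine_rate` (`TaoCascadeZeroScaleGrowth.lean`).

## References

* T. Tao, J. Amer. Math. Soc. 29 (2016), 601–674, arXiv:1402.0290v3, §6.4 (6.55), (6.57), §6.7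
  (6.157)–(6.158). [`Tao2016AveragedNS`]
-/

noncomputable section

open Set MeasureTheory intervalIntegral

namespace Literature.Analysis.FluidPDE

namespace TaoCascade

open Literature.Analysis.ODE

section CLower

variable {γ ε₀ K ε C₁ C₂ C₃ : ℝ} {n₀ N : ℤ} {τ : ℤ → ℝ} {Xr : Fin 4 → ℤ → ℝ → ℝ} {Er : ℤ → ℝ → ℝ}

/-- **(6.157): `b₀` is affine around `εt`.** On `[0, T]` (`0 ≤ T`) with `Ẽ₀ ≤ 1`, `|a₀² - 1| ≤ c_A`,
`|c₀| ≤ C`: `εt - p ≤ b₀(t) ≤ εt + p`, `p = 10⁻⁵ε + (εc_A + ε⁻¹K^{10}C² + C₁(1+ε₀)^{-n₀/2})T` (`ε > 0`).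
[cite: Tao2016AveragedNS, §6.7 (6.157)] -/
theorem RescaledHypotheses.zero_b_affine
    (h : RescaledHypotheses γ ε₀ K ε C₁ C₂ C₃ n₀ N τ Xr Er) (hε : 0 < ε) (hC₁ : 0 ≤ C₁)
    (hε₀ : 0 < ε₀) (hN : n₀ ≤ N) {T cA C : ℝ} (hT : 0 ≤ T)
    (hreg : ∀ t ∈ Icc 0 T, Er 0 t ≤ 1) (hA : ∀ t ∈ Icc 0 T, |Xr 0 0 t ^ 2 - 1| ≤ cA)
    (hc : ∀ t ∈ Icc 0 T, |Xr 2 0 t| ≤ C) {t : ℝ} (ht : t ∈ Icc 0 T) :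
    ε * t - (1 / 10 ^ 5 * ε + (ε * cA + ε⁻¹ * K ^ 10 * C ^ 2 + C₁ * (1 + ε₀) ^ (-((n₀ : ℝ) / 2))) * T) ≤
        Xr 1 0 t ∧
      Xr 1 0 t ≤ ε * t + (1 / 10 ^ 5 * ε + (ε * cA + ε⁻¹ * K ^ 10 * C ^ 2 +
        C₁ * (1 + ε₀) ^ (-((n₀ : ℝ) / 2))) * T) := by
  have hτ0 : τ (n₀ - N) ≤ 0 := h.tau_le _ le_rfl (by omega)
  have hq0 : (0 : ℝ) < 1 + ε₀ := by linarith
  have hη : 0 ≤ C₁ * (1 + ε₀) ^ (-((n₀ : ℝ) / 2)) := mul_nonneg hC₁ (Real.rpow_nonneg hq0.le _)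
  have hcA : 0 ≤ cA := (abs_nonneg _).trans (hA 0 ⟨le_rfl, hT⟩)
  have hCC : 0 ≤ C := (abs_nonneg _).trans (hc 0 ⟨le_rfl, hT⟩)
  have hb0 := abs_le.mp h.b_abs_le
  have hμ : 0 ≤ ε⁻¹ * K ^ 10 * C ^ 2 := by positivity
  -- upper: `a₀² ≤ 1 + cA`
  have hAhi : ∀ s ∈ Icc 0 T, Xr 0 0 s ^ 2 ≤ Real.sqrt (1 + cA) ^ 2 := by
    intro s hs
    rw [Real.sq_sqrt (by linarith)]
    linarith [(abs_le.mp (hA s hs)).2]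
  have hAlo : ∀ s ∈ Icc 0 T, 1 - cA ≤ Xr 0 0 s ^ 2 := fun s hs => by linarith [(abs_le.mp (hA s hs)).1]
  have hup := h.zero_b_upper_on hε.le hC₁ hε₀ hτ0 hreg hAhi ht
  have hlo := h.zero_b_lower_on hε.le hC₁ hε₀ hτ0 hreg hAlo hc ht
  rw [Real.sq_sqrt (by linarith), sub_zero] at hup
  rw [sub_zero] at hlo
  constructor
  · -- lower bound
    have h1 : (ε * (1 - cA) - ε⁻¹ * K ^ 10 * C ^ 2 - C₁ * (1 + ε₀) ^ (-((n₀ : ℝ) / 2))) * t =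
        ε * t - (ε * cA + ε⁻¹ * K ^ 10 * C ^ 2 + C₁ * (1 + ε₀) ^ (-((n₀ : ℝ) / 2))) * t := by ring
    have h2 : (ε * cA + ε⁻¹ * K ^ 10 * C ^ 2 + C₁ * (1 + ε₀) ^ (-((n₀ : ℝ) / 2))) * t ≤
        (ε * cA + ε⁻¹ * K ^ 10 * C ^ 2 + C₁ * (1 + ε₀) ^ (-((n₀ : ℝ) / 2))) * T :=
      mul_le_mul_of_nonneg_left ht.2 (by positivity)
    linarith [hb0.1]
  · have h1 : (ε * (1 + cA) + C₁ * (1 + ε₀) ^ (-((n₀ : ℝ) / 2))) * t =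
        ε * t + (ε * cA + C₁ * (1 + ε₀) ^ (-((n₀ : ℝ) / 2))) * t := by ring
    have h2 : (ε * cA + C₁ * (1 + ε₀) ^ (-((n₀ : ℝ) / 2))) * t ≤
        (ε * cA + ε⁻¹ * K ^ 10 * C ^ 2 + C₁ * (1 + ε₀) ^ (-((n₀ : ℝ) / 2))) * T := by
      have h3 : (ε * cA + C₁ * (1 + ε₀) ^ (-((n₀ : ℝ) / 2))) * t ≤
          (ε * cA + C₁ * (1 + ε₀) ^ (-((n₀ : ℝ) / 2))) * T :=
        mul_le_mul_of_nonneg_left ht.2 (by positivity)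
      nlinarith
    linarith [hb0.2]

/-- **The explicit lower bound for `c₀` before `t_c`** (display before (6.158)). On `[0, T]` (`0 ≤ T`)
with `Ẽ₀ ≤ 1`, `|a₀² - 1| ≤ c_A`, `|c₀| ≤ C`, with `p` as in `zero_b_affine`, `λ₀ = ε²e^{-K^{10}}(1 - c_A)`,
`η = C₁(1+ε₀)^{-n₀/2} ≤ λ₀`: for `t ∈ [0, T]` and `0 < w ≤ t`,
`c₀(t) ≥ exp(ε⁻¹K^{10}(εt²/2 - pt))·((λ₀ - η)we^{-ε⁻¹K^{10}(εw²/2+pw)} - (1+ε₀)^{-n₀/4})` whenever the last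
factor is nonnegative. [cite: Tao2016AveragedNS, §6.7 (6.158)] -/
theorem RescaledHypotheses.zero_c_lower_explicit
    (h : RescaledHypotheses γ ε₀ K ε C₁ C₂ C₃ n₀ N τ Xr Er) (hε : 0 < ε) (hC₁ : 0 ≤ C₁)
    (hε₀ : 0 < ε₀) (hN : n₀ ≤ N) {T cA C : ℝ} (hT : 0 ≤ T)
    (hreg : ∀ t ∈ Icc 0 T, Er 0 t ≤ 1) (hA : ∀ t ∈ Icc 0 T, |Xr 0 0 t ^ 2 - 1| ≤ cA)
    (hc : ∀ t ∈ Icc 0 T, |Xr 2 0 t| ≤ C)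
    (hle : C₁ * (1 + ε₀) ^ (-((n₀ : ℝ) / 2)) ≤ ε ^ 2 * Real.exp (-K ^ 10) * (1 - cA))
    {t w : ℝ} (ht : t ∈ Icc 0 T) (hw : 0 < w) (hwt : w ≤ t)
    (hX : 0 ≤ (ε ^ 2 * Real.exp (-K ^ 10) * (1 - cA) - C₁ * (1 + ε₀) ^ (-((n₀ : ℝ) / 2))) * w *
        Real.exp (-(ε⁻¹ * K ^ 10 * (ε * w ^ 2 / 2 +
          (1 / 10 ^ 5 * ε + (ε * cA + ε⁻¹ * K ^ 10 * C ^ 2 + C₁ * (1 + ε₀) ^ (-((n₀ : ℝ) / 2))) * T) * w))) -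
        (1 + ε₀) ^ (-(n₀ : ℝ) / 4)) :
    Real.exp (ε⁻¹ * K ^ 10 * (ε * (t - 0) ^ 2 / 2 -
        (1 / 10 ^ 5 * ε + (ε * cA + ε⁻¹ * K ^ 10 * C ^ 2 + C₁ * (1 + ε₀) ^ (-((n₀ : ℝ) / 2))) * T) *
          (t - 0))) *
        ((ε ^ 2 * Real.exp (-K ^ 10) * (1 - cA) - C₁ * (1 + ε₀) ^ (-((n₀ : ℝ) / 2))) * w *
            Real.exp (-(ε⁻¹ * K ^ 10 * (ε * w ^ 2 / 2 +
              (1 / 10 ^ 5 * ε + (ε * cA + ε⁻¹ * K ^ 10 * C ^ 2 + C₁ * (1 + ε₀) ^ (-((n₀ : ℝ) / 2))) * T) *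
                w))) -
          (1 + ε₀) ^ (-(n₀ : ℝ) / 4)) ≤ Xr 2 0 t := by
  have hτ0 : τ (n₀ - N) ≤ 0 := h.tau_le _ le_rfl (by omega)
  have hq0 : (0 : ℝ) < 1 + ε₀ := by linarith
  have hη : 0 ≤ C₁ * (1 + ε₀) ^ (-((n₀ : ℝ) / 2)) := mul_nonneg hC₁ (Real.rpow_nonneg hq0.le _)
  have hcA : 0 ≤ cA := (abs_nonneg _).trans (hA 0 ⟨le_rfl, hT⟩)
  have hp : 0 ≤ 1 / 10 ^ 5 * ε + (ε * cA + ε⁻¹ * K ^ 10 * C ^ 2 + C₁ * (1 + ε₀) ^ (-((n₀ : ℝ) / 2))) * T := by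
    positivity
  have hAlo : ∀ s ∈ Icc 0 T, 1 - cA ≤ Xr 0 0 s ^ 2 := fun s hs => by linarith [(abs_le.mp (hA s hs)).1]
  refine c_lower_of_affine_rate (h.continuousOn_X 2 0 hτ0) (fun s hs => h.hasDeriv_X 2 0 (hτ0.trans hs.1))
    (h.continuousOn_X 1 0 hτ0) (by positivity) (b := T) ?_
    (fun s hs => by have := (h.zero_b_affine hε hC₁ hε₀ hN hT hreg hA hc hs).1; rw [sub_zero]; linarith)
    (fun s hs => by have := (h.zero_b_affine hε hC₁ hε₀ hN hT hreg hA hc hs).2; rw [sub_zero]; linarith)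
    hε.le hp (by simpa using h.c_ge) hle ht hw (by rw [sub_zero]; exact hwt) hX
  intro s hs
  have hs' : s ∈ Icc 0 T := Ico_subset_Icc_self hs
  have he := (abs_le.mp (h.eq_c_zero hC₁ (by linarith) (hτ0.trans hs.1) (hreg s hs'))).1
  have hsrc : ε ^ 2 * Real.exp (-K ^ 10) * (1 - cA) ≤ ε ^ 2 * Real.exp (-K ^ 10) * Xr 0 0 s ^ 2 :=
    mul_le_mul_of_nonneg_left (hAlo s hs') (by positivity)
  show _ ≤ derivWithin (Xr 2 0) (Ici (τ (n₀ - N))) s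
  linarith

end CLower

end TaoCascade

end Literature.Analysis.FluidPDE
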